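import Summits.BirchSwinnertonDyer.BirchSwinnertonDyer.Theorems.EisensteinPrimesIndexPlumbingNrVsStrictAtVbar
import Summits.BirchSwinnertonDyer.BirchSwinnertonDyer.Theorems.EisensteinPrimesIndexPlumbingNrVsStrictSub
import Summits.BirchSwinnertonDyer.BirchSwinnertonDyer.Theorems.EisensteinPrimesIndexPlumbingDictionary
import HarnessLib

/-!
# Route `EisensteinPrimes`, crux 2 `GoodLatticeBDPValue` (stmt-BirchSwinnertonDyer-19032), line `halves` v20.1, stub
# `stub_indexPlumbing`: **(B) + (C) ASSEMBLED — the `λ`-inequality of Keller–Yin Thm. 1.4.1 (iii) from the mid-level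
# index identity**, `λ(𝔛^{Sf}_nr(ω̃)) + λ(𝔛^{Sf}_nr(𝟙̃)) ≤ λ(𝔛^{Sf}_f) + [𝟙̃ = 𝟙]`

Cell `bsd-eis` (home `run/shared/lean/pub/bsd-eis/`), width seat `bsd-line-x1-p1-w8` («width 8»; `--supports -19032`,
closes nothing by itself). The LEAD's registered plumbing stub (halves v20, `Cruxes/GoodLatticeBDPValue/Lines/halves.lean`
l.361; v20.1 weakens its conclusion to `≤`, STATUS 2026-08-28T16:57:00Z) says: the MID-LEVEL identity
`zpCorank R(E_K[p^∞]) + ε = zpCorank R((F/𝒪)(θsub)) + zpCorank R((F/𝒪)(θquot)) + p^c` of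
`ResidualIndexAssembly.zpCorank_datumStrictSelmer_add_eq` (strict groups `R = datumStrictSelmer (ker κ) · p (bdpData · v̄) ↑Sf`,
`ε = [θquot = 𝟙]`) implies the `λ`-relation of the dual data. This file is that implication with NO further input:
* (C) `λ(𝔛^{Sf}_f) = zpCorank R(E_K[p^∞])` — w5's `IndexPlumbingDictionary.finite_torsionBy_and_lambdaInvariant_XAc_eq_zpCorank_datumStrictSelmer`
  (p648073: Castella's `Sel_v̄^{Sf}` IS `R(E_K[p^∞])` on the Heegner leaf; `λ = corank` for f.g. torsion `μ = 0`);
* (B2) `λ(DSsub.X) = zpCorank R((F/𝒪)(θsub))` — `lambdaInvariant_eq_zpCorank_grSelmer_sub_of_forall` (this seat, `…NrVsStrictSub`: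
  `θsub` is ramified at `v̄`, so strict = unramified there);
* (B1) `λ(DSquot.X) ≤ zpCorank R((F/𝒪)(θquot)) + p^c` — `lambdaInvariant_le_zpCorank_grSelmer_add_pow_quot_of_forall`
  (this seat, `…NrVsStrictAtVbar`: `D_v̄` acts trivially on `(F/𝒪)(θquot)`; the unramified local kernel embeds in `F/𝒪`);
then `omega`. Statement **`lambdaInvariant_add_le_of_mid`**: binders = a sub-list of the stub's (crux data `W p K v vbar ι κ γ
θsub θquot Sf` with their hypotheses, the dual data `DSsub DSquot`, the representatives `c τ` with `hreps` for `(F/𝒪)(θquot)`,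
the mid-level identity `hmid`, the three cotorsion facts of `𝔛^{Sf}_f` and the two `∀ D` clauses); the nine PUB antecedents,
`hτ`, `hdist`, `hreps` for the other two modules and the two SUR clauses of the stub are NOT used.

HONEST FRAMING: helper theorem only (0 definitions, 0 named facts, 0 sorry); it does not mention the `Theses`/`Cruxes` files
and closes no registered stub by itself (the LEAD's `stub_indexPlumbing` becomes `intro …; exact lambdaInvariant_add_le_of_mid …`
once v20.1 is registered); no summit statement, no BSD / IMC2 / KY Thm 1.4.1 (iii) is proved — the mid-level identity `hmid`
is a HYPOTHESIS here (it is the content of `stub_indexInputs` + `ResidualIndexAssembly`). References: [KellerYin2024]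
Thm. 1.4.1 (iii), §1.4 (arXiv:2402.12781v2 TeX L1087–1098, L1240–1330); the road memo
`Cruxes/GoodLatticeBDPValue/Lines/halves-imprimLambda-index-road.md` §2 (7)–(9).
-/

set_option autoImplicit false
-- the route's Theorems namespace repeats the summit name by design (D-0017 nested layout)
set_option linter.dupNamespace false

noncomputable section

open scoped Classical AddSubgroup

namespace Summit.BirchSwinnertonDyer.BirchSwinnertonDyer.Theorems.IndexPlumbingNrVsStrict

open Function NumberField IsDedekindDomain Field WeierstrassCurve
  Literature.NumberTheory.EllipticCurves Literature.NumberTheory.EllipticCurves.GreenbergSelmer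
  Literature.NumberTheory.EllipticCurves.GreenbergVatsal2000 Literature.NumberTheory.GaloisRepresentations
  Literature.NumberTheory.EllipticCurves.KellerYin2024 Literature.NumberTheory.IwasawaTheory
  Literature.NumberTheory.EllipticCurves.Rank1Residual Literature.NumberTheory.EllipticCurves.Castella2018

/-- `p ∈ v` for the place `v` read through `ι : K →+* ℚ_p` (`‖ι(p)‖ = ‖p‖_p < 1`); the crux binds `v` this way
(inlined from `IwasawaTwoVariable.natCast_mem_asIdeal_of_norm_iff` to keep the import light). [folklore] -/
theorem natCast_mem_asIdeal_of_forall_norm_iff {K : Type} [Field K] [NumberField K] {p : ℕ} [Fact p.Prime]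
    {ι : K →+* ℚ_[p]} {v : HeightOneSpectrum (𝓞 K)} (hvι : ∀ x : 𝓞 K, x ∈ v.asIdeal ↔ ‖ι (x : K)‖ < 1) :
    ((p : ℕ) : 𝓞 K) ∈ v.asIdeal := by
  rw [hvι]
  have h : ι (((p : ℕ) : 𝓞 K) : K) = (p : ℚ_[p]) := by
    rw [show (((p : ℕ) : 𝓞 K) : K) = (p : K) from rfl, map_natCast]
  rw [h]
  exact Padic.norm_p_lt_one

/-- **The `λ`-inequality of Keller–Yin Thm. 1.4.1 (iii) from the mid-level index identity — parts (B) + (C) of the LEAD's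
`stub_indexPlumbing` (halves v20.1) assembled.** On the data of the crux (`W/ℚ` globally minimal, `p` odd good anomalous with
the good-lattice normalisation, `K` imaginary quadratic with `p = v v̄`, `E(K)[p] = 0` not needed here, `κ` anticyclotomic with
topological generator `γ`, `(θsub, θquot)` the residual pair, `Sf` the places over `N_W`), for any dual data `DSsub`, `DSquot`,
representatives `τ i` (`i < p^c`) controlling the strict condition above `v̄` for `(F/𝒪)(θquot)`, and the cotorsion facts
(`𝔛^{Sf}_f` f.g. torsion `μ = 0`; `∀ D` for the two characters): the identity
`zpCorank R(E_K[p^∞]) + ε = zpCorank R((F/𝒪)(θsub)) + zpCorank R((F/𝒪)(θquot)) + p^c` IMPLIES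
`λ(DSsub.X) + λ(DSquot.X) ≤ λ(𝔛^{Sf}_f) + ε`, `ε = [θquot = 𝟙]`. [cite: KellerYin2024, Thm. 1.4.1 (iii) and §1.4 (arXiv:2402.12781v2 TeX L1087–1098, L1240–1260)] -/
theorem lambdaInvariant_add_le_of_mid
    (W : WeierstrassCurve ℚ) [W.IsElliptic] [W.IsGloballyMinimal] (p : ℕ) [Fact p.Prime]
    (hp : 2 < p) (hanom : Anom W p)
    (hlat : ∀ Φ : AddSubgroup (geomTorsion W (p : ℤ)), IsRationalLine W p Φ → ¬ LineUnramifiedAt W p Φ)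
    (K : Type) [Field K] [NumberField K] (hK : IsImaginaryQuadratic K)
    (ι : K →+* ℚ_[p]) (v vbar : HeightOneSpectrum (𝓞 K))
    (hv : ∀ x : 𝓞 K, x ∈ v.asIdeal ↔ ‖ι (x : K)‖ < 1)
    (hvbar : ((p : ℕ) : 𝓞 K) ∈ vbar.asIdeal) (hne : vbar ≠ v)
    (κ : ZpExtension K p) (hκ : κ.IsAnticyclotomic)
    (γ : absoluteGaloisGroup K) [Fact (κ.IsTopGenerator γ)]
    (θsub θquot : FramedGaloisRep K (padicCoeffIntegers (∅ : Set (PadicAlgCl p))) 1)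
    (hpair : IsResidualPairOver (W.baseChange K) p θsub θquot)
    (Sf : Finset (HeightOneSpectrum (𝓞 K)))
    (hSf : ∀ w : HeightOneSpectrum (𝓞 K), w ∈ Sf ↔ ((W.conductorNorm ℤ : ℤ) : 𝓞 K) ∈ w.asIdeal)
    (DSsub : DatumDualData κ γ (charModule ∅ θsub)
        (AcSelmer.bdpData (charModule ∅ θsub) p vbar) (↑Sf : Set (HeightOneSpectrum (𝓞 K))))
    (DSquot : DatumDualData κ γ (charModule ∅ θquot)
        (AcSelmer.bdpData (charModule ∅ θquot) p vbar) (↑Sf : Set (HeightOneSpectrum (𝓞 K))))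
    (c : ℕ) (τ : ℕ → absoluteGaloisGroup K)
    (hreps : ∀ x : subgroupH1 κ.kerSubgroup (charModule ∅ θquot),
      (∀ i, i < p ^ c → resOfLe (charModule ∅ θquot) (inf_le_left : κ.kerSubgroup ⊓ decomp vbar ≤ κ.kerSubgroup)
        (conjH1 κ.kerSubgroup (charModule ∅ θquot) (τ i) x) = 0) →
        ∀ σ : absoluteGaloisGroup K, resOfLe (charModule ∅ θquot)
          (inf_le_left : κ.kerSubgroup ⊓ decomp vbar ≤ κ.kerSubgroup)
          (conjH1 κ.kerSubgroup (charModule ∅ θquot) σ x) = 0)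
    (hmid : zpCorank (datumStrictSelmer κ.kerSubgroup ↥((W.baseChange K).geomPrimaryTorsion p) p
        (AcSelmer.bdpData ↥((W.baseChange K).geomPrimaryTorsion p) p vbar) (↑Sf : Set (HeightOneSpectrum (𝓞 K)))) p +
        (if ∀ σ : absoluteGaloisGroup K, θquot σ = 1 then 1 else 0) =
      zpCorank (datumStrictSelmer κ.kerSubgroup (charModule ∅ θsub) p (AcSelmer.bdpData (charModule ∅ θsub) p vbar)
          (↑Sf : Set (HeightOneSpectrum (𝓞 K)))) p +
        zpCorank (datumStrictSelmer κ.kerSubgroup (charModule ∅ θquot) p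
          (AcSelmer.bdpData (charModule ∅ θquot) p vbar) (↑Sf : Set (HeightOneSpectrum (𝓞 K)))) p + p ^ c)
    [Module.Finite (IwasawaAlgebra p) (AcSelmer.XAc (W.baseChange K) p κ vbar (↑Sf : Set (HeightOneSpectrum (𝓞 K))) γ)]
    (htorS : Module.IsTorsion (IwasawaAlgebra p)
      (AcSelmer.XAc (W.baseChange K) p κ vbar (↑Sf : Set (HeightOneSpectrum (𝓞 K))) γ))
    (hμS : muInvariant p (AcSelmer.XAc (W.baseChange K) p κ vbar (↑Sf : Set (HeightOneSpectrum (𝓞 K))) γ) = 0)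
    (hSsub : ∀ D : DatumDualData κ γ (charModule ∅ θsub)
        (AcSelmer.bdpData (charModule ∅ θsub) p vbar) (↑Sf : Set (HeightOneSpectrum (𝓞 K))),
      Module.Finite (IwasawaAlgebra p) D.X ∧ Module.IsTorsion (IwasawaAlgebra p) D.X ∧ muInvariant p D.X = 0)
    (hSquot : ∀ D : DatumDualData κ γ (charModule ∅ θquot)
        (AcSelmer.bdpData (charModule ∅ θquot) p vbar) (↑Sf : Set (HeightOneSpectrum (𝓞 K))),
      Module.Finite (IwasawaAlgebra p) D.X ∧ Module.IsTorsion (IwasawaAlgebra p) D.X ∧ muInvariant p D.X = 0) :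
    lambdaInvariant p DSsub.X + lambdaInvariant p DSquot.X ≤
      lambdaInvariant p (AcSelmer.XAc (W.baseChange K) p κ vbar (↑Sf : Set (HeightOneSpectrum (𝓞 K))) γ) +
        (if ∀ σ : absoluteGaloisGroup K, θquot σ = 1 then 1 else 0) := by
  have hp2 : p ≠ 2 := by omega
  have hpv : ((p : ℕ) : 𝓞 K) ∈ v.asIdeal := natCast_mem_asIdeal_of_forall_norm_iff hv
  -- (C): `λ(𝔛^{Sf}_f) = zpCorank R(E_K[p^∞])`
  obtain ⟨-, hC⟩ := IndexPlumbingDictionary.finite_torsionBy_and_lambdaInvariant_XAc_eq_zpCorank_datumStrictSelmer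
    W p K vbar κ Sf hK hvbar γ hSf htorS hμS
  -- (B2): `λ(DSsub.X) = zpCorank R(θsub)`
  have hB2 := lambdaInvariant_eq_zpCorank_grSelmer_sub_of_forall W κ hp2 hanom hlat hK hpv hvbar hne hpair
    (↑Sf : Set (HeightOneSpectrum (𝓞 K))) DSsub hSsub
  -- (B1): `λ(DSquot.X) ≤ zpCorank R(θquot) + p^c`
  have hB1 := lambdaInvariant_le_zpCorank_grSelmer_add_pow_quot_of_forall W κ hp2 hanom hlat hK hpv hvbar hne hκ hpair
    (↑Sf : Set (HeightOneSpectrum (𝓞 K))) c τ hreps DSquot hSquot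
  change lambdaInvariant p DSsub.X = zpCorank ↥(datumStrictSelmer κ.kerSubgroup (charModule ∅ θsub) p
    (AcSelmer.bdpData (charModule ∅ θsub) p vbar) (↑Sf : Set (HeightOneSpectrum (𝓞 K)))) p at hB2
  change lambdaInvariant p DSquot.X ≤ zpCorank ↥(datumStrictSelmer κ.kerSubgroup (charModule ∅ θquot) p
    (AcSelmer.bdpData (charModule ∅ θquot) p vbar) (↑Sf : Set (HeightOneSpectrum (𝓞 K)))) p + p ^ c at hB1
  omega

end Summit.BirchSwinnertonDyer.BirchSwinnertonDyer.Theorems.IndexPlumbingNrVsStrict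

end
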